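import Mathlib

/-!
# Route `SymPencil` — inner rank of the `2 | 2` row split of `per_4`, PEELED case: the
# Taussky–Zassenhaus step (`--supports` stmt-ValiantsHypothesis-5674 `SdcSuperquadratic`; (8,8) column,
# memo `NOTE-p6g16-5674-R2-peeled-ten.md` §2)

Pure linear algebra over a field of characteristic zero (no project imports).  The classical
Taussky–Zassenhaus theorem says: if `S` is a nonderogatory matrix then every `X` with `X S = Sᵀ X` is
symmetric; hence an ALTERNATING such `X` vanishes.  We prove the two inverse-free instances the
peeled-case argument uses, for `4 × 4` matrices:

* `eq_zero_of_chain` — `Aᵀ = -A`, `A * S = Sᵀ * A`, and a Krylov chain `u₀, u₁ = S u₀, u₂ = S u₁,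
  u₃ = S u₂` forming a basis (the matrix of the `uᵢ` has a left inverse) force `A = 0`
  (the Gram values `uᵢᵀ A uⱼ` form a Hankel AND antisymmetric array, hence vanish);
* `eq_zero_of_eigen` — the same with an eigenbasis `S vⱼ = sⱼ vⱼ`, `sⱼ` pairwise distinct;
* pencil wrappers `eq_zero_of_pencil_chain`, `eq_zero_of_pencil_eigen` where `S` is only known
  through `P₀ * S = P₁` with `P₀` injective (`P₀ u_{k+1} = P₁ u_k`, resp. `P₁ vⱼ = sⱼ • P₀ vⱼ`).

In the application `A = [⟨ν(e_b,y), ν(e_{b'},y₀)⟩]` is the (alternating) cross-Gram of two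
maximal isotropic subspaces and `S` the transition matrix of the frame; see the memo.  Honest
framing: helper lemmas only; no cell of the size table closes here; `27 ≤ sdc(per_4) ≤ 29`, the crux
and `VP ≠ VNP` are untouched.  No definitions, no named facts. [folklore]
-/

noncomputable section

-- single-conjunct layout: Sub = Summit, duplicated namespace component intended
set_option linter.dupNamespace false

namespace Summit.ValiantsHypothesis.ValiantsHypothesis.Theorems.SymPencilPerFourPeeledTZ

open Matrix

variable {K : Type*} [Field K]

/-- The Gram value `uᵀ A w` of an antisymmetric matrix is antisymmetric in `(u, w)`. [folklore] -/
theorem dot_mulVec_antisymm {n : Type*} [Fintype n] (A : Matrix n n K) (hA : Aᵀ = -A)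
    (u w : n → K) : u ⬝ᵥ A *ᵥ w = -(w ⬝ᵥ A *ᵥ u) := by
  have h1 : u ⬝ᵥ A *ᵥ w = (u ᵥ* A) ⬝ᵥ w := (dotProduct_mulVec u A w)
  rw [h1, ← mulVec_transpose, hA, neg_mulVec, neg_dotProduct, dotProduct_comm]

/-- `uᵀ A (S w) = (S u)ᵀ A w` when `A S = Sᵀ A` (the matrix `S` is self-adjoint for the form `A`).
[folklore] -/
theorem dot_mulVec_selfAdjoint {n : Type*} [Fintype n] (A S : Matrix n n K) (hAS : A * S = Sᵀ * A)
    (u w : n → K) : u ⬝ᵥ A *ᵥ (S *ᵥ w) = (S *ᵥ u) ⬝ᵥ A *ᵥ w := by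
  rw [mulVec_mulVec, hAS, ← mulVec_mulVec, dotProduct_mulVec, vecMul_transpose]

/-- A bilinear test: if `uᵢᵀ A uⱼ = 0` for the rows `uᵢ` of a matrix `U` with a left inverse
`W * U = 1`, then `A = 0`. [folklore] -/
theorem eq_zero_of_gram_rows_eq_zero {n : Type*} [Fintype n] [DecidableEq n] (A U W : Matrix n n K)
    (hW : W * U = 1) (h : ∀ i j, U i ⬝ᵥ A *ᵥ U j = 0) : A = 0 := by
  have hUAU : U * A * Uᵀ = 0 := by
    ext i j
    rw [Matrix.mul_assoc]
    simpa only [Matrix.mul_apply, dotProduct, mulVec, transpose_apply, Matrix.zero_apply] using h i j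
  have hWt : Uᵀ * Wᵀ = 1 := by rw [← transpose_mul, hW, transpose_one]
  calc A = (W * U) * A * (Uᵀ * Wᵀ) := by rw [hW, hWt, Matrix.one_mul, Matrix.mul_one]
    _ = W * (U * A * Uᵀ) * Wᵀ := by simp only [Matrix.mul_assoc]
    _ = 0 := by rw [hUAU, Matrix.mul_zero, Matrix.zero_mul]

/-- **Taussky–Zassenhaus, Krylov-chain form.**  An alternating `4 × 4` matrix `A` with `A S = Sᵀ A`
vanishes as soon as `S` has a cyclic vector: `u (k+1) = S u k` and the matrix of rows `u k` has a
left inverse.  Proof: `a i j := uᵢᵀ A uⱼ` satisfies `a i (j+1) = a (i+1) j` (Hankel) and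
`a i j = - a j i`, so all sixteen values vanish. [folklore] -/
theorem eq_zero_of_chain [CharZero K] (A S : Matrix (Fin 4) (Fin 4) K) (hA : Aᵀ = -A)
    (hAS : A * S = Sᵀ * A) (u : Fin 4 → Fin 4 → K)
    (h1 : u 1 = S *ᵥ u 0) (h2 : u 2 = S *ᵥ u 1) (h3 : u 3 = S *ᵥ u 2)
    (W : Matrix (Fin 4) (Fin 4) K) (hW : W * Matrix.of u = 1) : A = 0 := by
  set a : Fin 4 → Fin 4 → K := fun i j => u i ⬝ᵥ A *ᵥ u j with ha
  have anti : ∀ i j, a i j = -a j i := fun i j => dot_mulVec_antisymm A hA (u i) (u j)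
  have diag : ∀ i, a i i = 0 := fun i => by
    have h := anti i i
    have h2 : (2 : K) * a i i = 0 := by rw [two_mul]; nth_rewrite 1 [h]; ring
    exact (mul_eq_zero.1 h2).resolve_left two_ne_zero
  -- Hankel shifts `a i (j+1) = a (i+1) j`
  have s01 : a 0 1 = a 1 0 := by
    simp only [ha]; rw [h1]; exact dot_mulVec_selfAdjoint A S hAS (u 0) (u 0)
  have s02 : a 0 2 = a 1 1 := by
    simp only [ha]; rw [h2, dot_mulVec_selfAdjoint A S hAS, ← h1]
  have s12 : a 1 2 = a 2 1 := by
    simp only [ha]; rw [h2]; exact dot_mulVec_selfAdjoint A S hAS (u 1) (u 1)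
  have s03 : a 0 3 = a 1 2 := by
    simp only [ha]; rw [h3, dot_mulVec_selfAdjoint A S hAS, ← h1]
  have s13 : a 1 3 = a 2 2 := by
    simp only [ha]; rw [h3, dot_mulVec_selfAdjoint A S hAS, ← h2]
  have s23 : a 2 3 = a 3 2 := by
    simp only [ha]; rw [h3]; exact dot_mulVec_selfAdjoint A S hAS (u 2) (u 2)
  have half : ∀ x : K, x = -x → x = 0 := fun x hx => by
    have h2 : (2 : K) * x = 0 := by linear_combination hx
    exact (mul_eq_zero.1 h2).resolve_left two_ne_zero
  have d0 : a 0 0 = 0 := diag 0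
  have d1 : a 1 1 = 0 := diag 1
  have d2 : a 2 2 = 0 := diag 2
  have d3 : a 3 3 = 0 := diag 3
  have z01 : a 0 1 = 0 := half _ (by nth_rewrite 2 [s01]; exact anti 0 1)
  have z02 : a 0 2 = 0 := by rw [s02, d1]
  have z12 : a 1 2 = 0 := half _ (by nth_rewrite 2 [s12]; exact anti 1 2)
  have z03 : a 0 3 = 0 := by rw [s03, z12]
  have z13 : a 1 3 = 0 := by rw [s13, d2]
  have z23 : a 2 3 = 0 := half _ (by nth_rewrite 2 [s23]; exact anti 2 3)
  have z10 : a 1 0 = 0 := by rw [anti, z01, neg_zero]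
  have z20 : a 2 0 = 0 := by rw [anti, z02, neg_zero]
  have z21 : a 2 1 = 0 := by rw [anti, z12, neg_zero]
  have z30 : a 3 0 = 0 := by rw [anti, z03, neg_zero]
  have z31 : a 3 1 = 0 := by rw [anti, z13, neg_zero]
  have z32 : a 3 2 = 0 := by rw [anti, z23, neg_zero]
  have hall : ∀ i j, a i j = 0 := by
    intro i j
    fin_cases i <;> fin_cases j <;> assumption
  exact eq_zero_of_gram_rows_eq_zero A (Matrix.of u) W hW (fun i j => hall i j)

/-- **Taussky–Zassenhaus, eigenbasis form.**  An alternating `A` with `A S = Sᵀ A` vanishes if `S`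
has an eigenbasis with pairwise distinct eigenvalues (`(sᵢ - sⱼ) · vᵢᵀ A vⱼ = 0`). [folklore] -/
theorem eq_zero_of_eigen [CharZero K] {n : Type*} [Fintype n] [DecidableEq n]
    (A S : Matrix n n K) (hA : Aᵀ = -A) (hAS : A * S = Sᵀ * A)
    (v : n → n → K) (s : n → K) (hv : ∀ j, S *ᵥ v j = s j • v j)
    (hs : ∀ i j, i ≠ j → s i ≠ s j)
    (W : Matrix n n K) (hW : W * Matrix.of v = 1) : A = 0 := by
  refine eq_zero_of_gram_rows_eq_zero A (Matrix.of v) W hW (fun i j => ?_)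
  change v i ⬝ᵥ A *ᵥ v j = 0
  by_cases hij : i = j
  · subst hij
    have h := dot_mulVec_antisymm A hA (v i) (v i)
    have h2 : (2 : K) * (v i ⬝ᵥ A *ᵥ v i) = 0 := by linear_combination h
    exact (mul_eq_zero.1 h2).resolve_left two_ne_zero
  · have h := dot_mulVec_selfAdjoint A S hAS (v i) (v j)
    rw [hv j, hv i, mulVec_smul, dotProduct_smul, smul_dotProduct, smul_eq_mul, smul_eq_mul] at h
    have h' : (s j - s i) * (v i ⬝ᵥ A *ᵥ v j) = 0 := by linear_combination h
    exact (mul_eq_zero.1 h').resolve_left (sub_ne_zero.2 (hs j i (Ne.symm hij)))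

/-- **Pencil form of the chain criterion.**  If `S` is known only through `P₀ * S = P₁` with `P₀`
having a left inverse, a chain `P₀ u_{k+1} = P₁ u_k` is a Krylov chain of `S`. [folklore] -/
theorem eq_zero_of_pencil_chain [CharZero K] (A S P₀ P₁ : Matrix (Fin 4) (Fin 4) K) (hA : Aᵀ = -A)
    (hAS : A * S = Sᵀ * A) (hP : P₀ * S = P₁) (W₀ : Matrix (Fin 4) (Fin 4) K) (hW₀ : W₀ * P₀ = 1)
    (u : Fin 4 → Fin 4 → K)
    (h1 : P₀ *ᵥ u 1 = P₁ *ᵥ u 0) (h2 : P₀ *ᵥ u 2 = P₁ *ᵥ u 1) (h3 : P₀ *ᵥ u 3 = P₁ *ᵥ u 2)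
    (W : Matrix (Fin 4) (Fin 4) K) (hW : W * Matrix.of u = 1) : A = 0 := by
  have key : ∀ x y : Fin 4 → K, P₀ *ᵥ x = P₁ *ᵥ y → x = S *ᵥ y := by
    intro x y h
    have : W₀ *ᵥ (P₀ *ᵥ x) = W₀ *ᵥ (P₁ *ᵥ y) := by rw [h]
    rwa [mulVec_mulVec, mulVec_mulVec, hW₀, one_mulVec, ← hP, ← Matrix.mul_assoc, hW₀,
      Matrix.one_mul] at this
  exact eq_zero_of_chain A S hA hAS u (key _ _ h1) (key _ _ h2) (key _ _ h3) W hW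

/-- **Pencil form of the eigenbasis criterion**: `P₁ vⱼ = sⱼ • P₀ vⱼ` with `P₀ * S = P₁`, `P₀`
left-invertible. [folklore] -/
theorem eq_zero_of_pencil_eigen [CharZero K] {n : Type*} [Fintype n] [DecidableEq n]
    (A S P₀ P₁ : Matrix n n K) (hA : Aᵀ = -A) (hAS : A * S = Sᵀ * A) (hP : P₀ * S = P₁)
    (W₀ : Matrix n n K) (hW₀ : W₀ * P₀ = 1)
    (v : n → n → K) (s : n → K) (hv : ∀ j, P₁ *ᵥ v j = s j • P₀ *ᵥ v j)
    (hs : ∀ i j, i ≠ j → s i ≠ s j)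
    (W : Matrix n n K) (hW : W * Matrix.of v = 1) : A = 0 := by
  refine eq_zero_of_eigen A S hA hAS v s (fun j => ?_) hs W hW
  have h : W₀ *ᵥ (P₁ *ᵥ v j) = W₀ *ᵥ (s j • P₀ *ᵥ v j) := by rw [hv j]
  rw [mulVec_smul, mulVec_mulVec, mulVec_mulVec, hW₀, one_mulVec, ← hP, ← Matrix.mul_assoc, hW₀,
    Matrix.one_mul] at h
  exact h

end Summit.ValiantsHypothesis.ValiantsHypothesis.Theorems.SymPencilPerFourPeeledTZ

end
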